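import Summits.BirchSwinnertonDyer.BirchSwinnertonDyer.Theorems.KimAtThreeD7uTamagawaComponentDescent
import Literature.NumberTheory.EllipticCurves.KodairaNeronSplitCyclicProofs
import Literature.NumberTheory.EllipticCurves.KodairaNeronLeFourProofs
import Literature.NumberTheory.DiophantineGeometry.Conductor
import Literature.RingTheory.DiscreteValuationRing.AdicCompletionHensel
import HarnessLib

/-!
# The TAMAGAWA-DIVISIBLE bad places, XIV: `p^{k+1} ∣ c_w ⇒ Φ_w[p^k] ⊆ p Φ_w` for every ODD `p`, by
# Kodaira–Néron (the hypothesis of parts XI–XIII discharged from the Tamagawa number alone)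
# (cell `bsd-addord`, seat w2-tamdiv gen 5; route W2 `KimAtThreeKolyvagin`, items 19562 / 19560, «TamDiv∞»)

HONEST FRAMING: TOOL theorems (no definition, no named fact, no `sorry`); closes nothing by itself;
nothing is booked; BSD is not proved by any of this.  Every input is a theorem of the tree
(Kodaira–Néron for split multiplicative reduction over a Henselian ring,
`isAddCyclic_quotient_goodReductionSubgroup_of_hasSplitMultiplicativeReduction`; the index bound `≤ 4`
off the split case, `index_goodReductionSubgroup_le_four_holds`).

## What (E/ℚ, `w` a finite place, `Φ_w = X(ℚ_w)/X₀(ℚ_w)` the component quotient of the minimal model,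
`#Φ_w = c_w`)

* §1 `componentQuotient_torsionBy_le_smul_of_isAddCyclic`: `Φ_w` cyclic and `p^{k+1} ∣ c_w` ⇒
  `Φ_w[p^k] ⊆ p Φ_w` (a generator `g` of order `c_w`; `p^k • a g = 0` forces `p^{k+1} ∣ p^k a`, `p ∣ a`).
* §2 `isAddCyclic_componentQuotient_of_hasSplitMultiplicativeReductionAt`: at a split multiplicative
  place `Φ_w` is cyclic (Kodaira–Néron, *ATAEC* IV.9.2(d); the tree's theorem on the minimal model read
  on part IV's quotient through `map_localMinimalIntegralModel_eq` and `goodReductionSubgroup_baseChange_eq`).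
* §3 **`componentQuotient_torsionBy_le_smul_of_pow_succ_dvd`**: for ODD `p`, `p^{k+1} ∣ c_w` ALONE gives
  `Φ_w[p^k] ⊆ p Φ_w`: for `k = 0` there is nothing to prove; for `k ≥ 1`, `p² ∣ c_w` forces `c_w ≥ 9 > 4`,
  so the reduction is split multiplicative (off the split case `c_w ≤ 4`) and §2, §1 apply.  Hence the
  cartesian criterion of part XI and the every-exponent defect of part XIII hold under `3^{k+1} ∣ c_ℓ`
  with no hypothesis on the reduction type.

References: J. H. Silverman, *ATAEC* Cor. IV.9.2 (b), (d); *AEC* Thm. VII.6.1, Cor. C.15.2.1;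
K. Büyükboduk, JNT 129 (2009) §3 (the remark before Cor. 3.3: `p > 3`, `p ∣ c_ℓ ⇒` split multiplicative).
-/

noncomputable section

-- the cell's Theorems namespace `Summit.BirchSwinnertonDyer.BirchSwinnertonDyer.…` repeats the summit name by design (D-0017)
set_option linter.dupNamespace false

open Function Field IsDedekindDomain NumberField
open scoped NumberField Classical
open Literature.NumberTheory.GaloisRepresentations Literature.NumberTheory.EllipticCurves
open WeierstrassCurve
open Summit.BirchSwinnertonDyer.Rank1Residual.X11b.AcSelmer
open Summit.BirchSwinnertonDyer.BirchSwinnertonDyer.Theorems.KimAtThreeD7uTamagawaIndex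

namespace Summit.BirchSwinnertonDyer.BirchSwinnertonDyer.Theorems.KimAtThreeD7uTamagawaCartesian

variable (W : WeierstrassCurve ℚ) [W.IsElliptic] (p : ℕ) [hp : Fact p.Prime] (k : ℕ)
  (w : HeightOneSpectrum (𝓞 ℚ))

/-! ### §1 Cyclic component group -/

omit [W.IsElliptic] in
/-- **`Φ_w` cyclic and `p^{k+1} ∣ c_w` ⇒ `Φ_w[p^k] ⊆ p Φ_w`**: with a generator `g` (of order `#Φ_w = c_w`),
an element `φ = a • g` with `p^k • φ = 0` has `c_w ∣ p^k a`, so `p^{k+1} ∣ p^k a` and `p ∣ a`.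
[cite: Buyukboduk2009TamagawaDefect, Thm. 3.1 and Cor. 3.3 (§3)] -/
theorem componentQuotient_torsionBy_le_smul_of_isAddCyclic
    (hcyc : IsAddCyclic (((W.localMinimalIntegralModel w).baseChange (w.adicCompletion ℚ)).toAffine.Point ⧸
        (W.localMinimalIntegralModel w).nonsingularReductionSubgroup
          (integers_valuationRing_valuation (w.adicCompletionIntegers ℚ) (w.adicCompletion ℚ))))
    (hk : p ^ (k + 1) ∣ (W.baseChange (w.adicCompletion ℚ)).localTamagawaNumber (w.adicCompletionIntegers ℚ))
    (φ : ((W.localMinimalIntegralModel w).baseChange (w.adicCompletion ℚ)).toAffine.Point ⧸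
        (W.localMinimalIntegralModel w).nonsingularReductionSubgroup
          (integers_valuationRing_valuation (w.adicCompletionIntegers ℚ) (w.adicCompletion ℚ)))
    (hφ : p ^ k • φ = 0) :
    ∃ ψ : ((W.localMinimalIntegralModel w).baseChange (w.adicCompletion ℚ)).toAffine.Point ⧸
        (W.localMinimalIntegralModel w).nonsingularReductionSubgroup
          (integers_valuationRing_valuation (w.adicCompletionIntegers ℚ) (w.adicCompletion ℚ)),
      p • ψ = φ := by
  have hpp : p.Prime := hp.out
  obtain ⟨g, hg⟩ := IsAddCyclic.exists_generator
    (α := ((W.localMinimalIntegralModel w).baseChange (w.adicCompletion ℚ)).toAffine.Point ⧸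
        (W.localMinimalIntegralModel w).nonsingularReductionSubgroup
          (integers_valuationRing_valuation (w.adicCompletionIntegers ℚ) (w.adicCompletion ℚ)))
  -- `addOrderOf g = #Φ_w = c_w`
  have hord : addOrderOf g = (W.baseChange (w.adicCompletion ℚ)).localTamagawaNumber
      (w.adicCompletionIntegers ℚ) := by
    rw [← natCard_componentQuotient_eq_localTamagawaNumber, ← Nat.card_zmultiples g,
      (AddSubgroup.eq_top_iff' _).mpr hg, AddSubgroup.card_top]
  obtain ⟨a, rfl⟩ := (AddSubgroup.mem_zmultiples_iff).mp (hg φ)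
  -- `c_w ∣ p^k a`, hence `p^{k+1} ∣ p^k a` and `p ∣ a`
  have h1 : ((addOrderOf g : ℕ) : ℤ) ∣ (p : ℤ) ^ k * a := by
    rw [addOrderOf_dvd_iff_zsmul_eq_zero, mul_smul, ← Nat.cast_pow, natCast_zsmul]
    exact hφ
  have h2 : (p : ℤ) ^ k * (p : ℤ) ∣ (p : ℤ) ^ k * a := by
    have h : ((p ^ (k + 1) : ℕ) : ℤ) ∣ (p : ℤ) ^ k * a := (Int.natCast_dvd_natCast.mpr hk).trans (hord ▸ h1)
    rwa [Nat.cast_pow, pow_succ] at h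
  have hpk : (p : ℤ) ^ k ≠ 0 := pow_ne_zero _ (by exact_mod_cast hpp.ne_zero)
  obtain ⟨b, rfl⟩ := (mul_dvd_mul_iff_left hpk).mp h2
  refine ⟨b • g, ?_⟩
  rw [← natCast_zsmul, smul_smul]

/-! ### §2 Split multiplicative reduction: `Φ_w` is cyclic (Kodaira–Néron) -/

/-- **At a split multiplicative place the component quotient `Φ_w = X(ℚ_w)/X₀(ℚ_w)` is cyclic**
(Kodaira–Néron, *ATAEC* Cor. IV.9.2(d): `E(K)/E₀(K) ≅ ℤ/ord(Δ)` over a Henselian field; the tree's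
`isAddCyclic_quotient_goodReductionSubgroup_of_hasSplitMultiplicativeReduction` on the minimal model
`W.localMinimalModel w = M ⊗ ℚ_w` (`map_localMinimalIntegralModel_eq`), whose `goodReductionSubgroup` is
part IV's `X₀(ℚ_w) = nonsingularReductionSubgroup` (`goodReductionSubgroup_baseChange_eq`)).
[cite: SilvermanATAEC1994, Cor. IV.9.2 (d) (PDF p. 340)] [cite: SilvermanAEC2009, Thm. VII.6.1] -/
theorem isAddCyclic_componentQuotient_of_hasSplitMultiplicativeReductionAt
    (hs : W.HasSplitMultiplicativeReductionAt w) :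
    IsAddCyclic (((W.localMinimalIntegralModel w).baseChange (w.adicCompletion ℚ)).toAffine.Point ⧸
        (W.localMinimalIntegralModel w).nonsingularReductionSubgroup
          (integers_valuationRing_valuation (w.adicCompletionIntegers ℚ) (w.adicCompletion ℚ))) := by
  haveI : HenselianRing (w.adicCompletionIntegers ℚ) (IsLocalRing.maximalIdeal _) := inferInstance
  haveI : ((W.localMinimalIntegralModel w).baseChange (w.adicCompletion ℚ)).IsMinimal
      (w.adicCompletionIntegers ℚ) := W.isMinimal_map_localMinimalIntegralModel (v := w)
  haveI : ((W.localMinimalIntegralModel w).baseChange (w.adicCompletion ℚ)).IsElliptic :=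
    W.isElliptic_map_localMinimalIntegralModel (v := w)
  haveI : ((W.localMinimalIntegralModel w).baseChange (w.adicCompletion ℚ)).HasSplitMultiplicativeReduction
      (w.adicCompletionIntegers ℚ) := by
    have h : (W.localMinimalModel w).HasSplitMultiplicativeReduction (w.adicCompletionIntegers ℚ) := hs
    rw [← W.map_localMinimalIntegralModel_eq (v := w)] at h
    exact h
  have h := ((W.localMinimalIntegralModel w).baseChange
    (w.adicCompletion ℚ)).isAddCyclic_quotient_goodReductionSubgroup_of_hasSplitMultiplicativeReduction
    (w.adicCompletionIntegers ℚ)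
  rwa [goodReductionSubgroup_baseChange_eq] at h

/-! ### §3 Odd `p`: `p^{k+1} ∣ c_w` alone -/

/-- **`p^{k+1} ∣ c_w ⇒ Φ_w[p^k] ⊆ p Φ_w` for every ODD prime `p`**, no hypothesis on the reduction type:
for `k = 0` trivially (`ψ = 0`... rather `φ = 0`); for `k ≥ 1`, `p² ∣ c_w` gives `c_w ≥ p² ≥ 9 > 4`, so
the minimal model is split multiplicative at `w` (otherwise `c_w ≤ 4`, Kodaira–Néron
`index_goodReductionSubgroup_le_four_holds`), `Φ_w` is cyclic (§2) and §1 applies.  This is the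
hypothesis `hΦ` of parts XI–XIII; Büyükboduk's remark «`p > 3`, `p ∣ c_ℓ ⇒` split multiplicative» is the
case `k ≥ 0` of the same dichotomy for `p ≥ 5`.
[cite: SilvermanATAEC1994, Cor. IV.9.2 (d) (PDF p. 340)] [cite: Buyukboduk2009TamagawaDefect, §3 before Cor. 3.3] -/
theorem componentQuotient_torsionBy_le_smul_of_pow_succ_dvd (hodd : p ≠ 2)
    (hk : p ^ (k + 1) ∣ (W.baseChange (w.adicCompletion ℚ)).localTamagawaNumber (w.adicCompletionIntegers ℚ))
    (φ : ((W.localMinimalIntegralModel w).baseChange (w.adicCompletion ℚ)).toAffine.Point ⧸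
        (W.localMinimalIntegralModel w).nonsingularReductionSubgroup
          (integers_valuationRing_valuation (w.adicCompletionIntegers ℚ) (w.adicCompletion ℚ)))
    (hφ : p ^ k • φ = 0) :
    ∃ ψ : ((W.localMinimalIntegralModel w).baseChange (w.adicCompletion ℚ)).toAffine.Point ⧸
        (W.localMinimalIntegralModel w).nonsingularReductionSubgroup
          (integers_valuationRing_valuation (w.adicCompletionIntegers ℚ) (w.adicCompletion ℚ)),
      p • ψ = φ := by
  have hpp : p.Prime := hp.out
  cases k with
  | zero =>
    refine ⟨0, ?_⟩
    rw [pow_zero, one_smul] at hφ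
    rw [hφ, smul_zero]
  | succ k =>
    by_cases hs : W.HasSplitMultiplicativeReductionAt w
    · exact componentQuotient_torsionBy_le_smul_of_isAddCyclic W p (k + 1) w
        (isAddCyclic_componentQuotient_of_hasSplitMultiplicativeReductionAt W w hs) hk φ hφ
    · exfalso
      -- off the split case `c_w ≤ 4`, but `p² ∣ c_w` with `p ≥ 3`
      haveI : PerfectField (IsLocalRing.ResidueField (w.adicCompletionIntegers ℚ)) := PerfectField.ofFinite
      haveI : (W.localMinimalModel w).IsElliptic := W.isElliptic_localMinimalModel w
      have hns : ¬ (W.localMinimalModel w).HasSplitMultiplicativeReduction (w.adicCompletionIntegers ℚ) := hs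
      have hle : (W.baseChange (w.adicCompletion ℚ)).localTamagawaNumber (w.adicCompletionIntegers ℚ) ≤ 4 :=
        ((W.localMinimalModel w).index_goodReductionSubgroup_le_four_holds (w.adicCompletionIntegers ℚ) hns).2
      have hc0 : (W.baseChange (w.adicCompletion ℚ)).localTamagawaNumber (w.adicCompletionIntegers ℚ) ≠ 0 :=
        W.localTamagawaNumber_baseChange_ne_zero w
      have h3 : 3 ≤ p := by
        rcases hpp.eq_two_or_odd' with h | h
        · exact absurd h hodd
        · exact Nat.succ_le_of_lt (lt_of_le_of_ne hpp.two_le (Ne.symm hodd))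
      have h9 : 9 ≤ p ^ (k + 1 + 1) :=
        calc 9 = 3 ^ 2 := by norm_num
          _ ≤ p ^ 2 := Nat.pow_le_pow_left h3 2
          _ ≤ p ^ (k + 1 + 1) := Nat.pow_le_pow_right hpp.pos (by omega)
      have := Nat.le_of_dvd (Nat.pos_of_ne_zero hc0) hk
      omega

end Summit.BirchSwinnertonDyer.BirchSwinnertonDyer.Theorems.KimAtThreeD7uTamagawaCartesian

end
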